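import Summits.CriticalPhenomena.PercolationContinuityZ3.Theorems.PercNearOneGluingAdditiveGluingGoodStepOneBond
import HarnessLib

/-! # Crux `PercNearOneGluing.AdditiveGluing` (stmt-CriticalPhenomena-4576), line `subuniform-dead-pocket-maximum` —
# the inductive step `stub_goodStep` reduced to a ONE-PAIR GLUING STEP (siege attempt k8)

Helper file for the crux skeleton `Cruxes/AdditiveGluing/Lines/subuniform-dead-pocket-maximum.lean`
(stubs `stub_lemma5AnyRelay`, `stub_goodBase` landed; `stub_goodStep` = Kozma–Nitzan's good-quadruple
inequality, arXiv:2401.12397 §3.2 p. 12, made inductive — open).  Lands `--supports stmt-CriticalPhenomena-4576`.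

## Content

Write `μ_w = prodBernoulli w`, `τ_w(a) = μ_w(a ↔ b)` and, for a selection `sel`,
`LHS_w(sel) = μ_w(o ↔ A, o ↮ b) + Σ_{W ∋ o, W ∩ A = ∅} μ_w(C(o) = W) · μ_w((sel W ↔ b in Wᶜ)ᶜ)`
(the left side of the registered stub; `GOOD(w, A, o, b)` says `LHS_w(sel) ≤ t` whenever
`1 − t ≤ τ_w` on `A`).

1. **One-bond calculus** (`goodStep_real_decomp`, `goodStep_lhs_affine`): for a pair `e = s(o, y)` at the
   observer, `μ_w(S) = (1 − w e) μ_{w[e↦0]}(S) + (w e) μ_{w[e↦1]}(S)` for every event `S`, and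
   `LHS_w(sel)` is affine in `w e` with the same endpoint values (the factors `μ((sel W ↔ b in Wᶜ)ᶜ)`,
   `o ∈ W`, do not see `e`).  Tools: `real_inter_closed_eq` (Negative/EdgeDeletion), the glue
   pushforward `stub_gluePushforward`, `prodBernoulli_map_sdiff_singleton`.
2. **Reduction** (`goodStep_of_glueStep`): the registered signature of `stub_goodStep` follows from the
   GLUING STEP
     `GlueStep`: for `w` with `w s(o,x) = 0` (`x ∉ A`, `x ≠ o`), `a₀ ∈ A` minimising `τ_w` over `A`,
     `GOOD(w, A, o, b)` and GOOD for every weight function with fewer positive-degree vertices: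
     `LHS_{w[s(o,x) ↦ 1]}(sel) ≤ 1 − τ_{w[s(o,x) ↦ 1]}(a₀)` for every selection `sel`
   (goodness of the quadruple with `x` glued onto `o`, measured AGAINST THE OLD MINIMISER `a₀`),
   by induction on the number of low neighbours of `o`: closing one low pair `e` gives a good `w[e↦0]`
   (induction / landed base `stub_goodBase` + `stub_lemma5AnyRelay`), and since `LHS` and `τ(a₀)` are
   affine in `w e`, the two endpoint inequalities (`GOOD(w[e↦0])` at level `1 − τ_{w[e↦0]}(a₀)` and
   `GlueStep`) interpolate to `LHS_w(sel) ≤ 1 − τ_w(a₀) ≤ t`.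

So the open inductive step is equivalent-in-practice to `GlueStep` ("DG1" in the siege notes): exact
partition-DP numerics (n ≤ 7 locally, adversarial hill-climbs incl. bounded weights) found no violation of
`GlueStep`; its infimum `0` is approached only on the degenerate locus where the observer is glued to the
worst relay — the same locus where `AdditiveGluing` itself is tight.  `GlueStep` is NOT proved here.
No new definitions; the hypothesis is displayed in full.
-/

namespace Summit.CriticalPhenomena.PercolationContinuityZ3.Theorems

open MeasureTheory Set
open Literature.Probability.LatticeModels (prodBernoulli)
open Literature.Probability.Percolation (BondConfig openConn openConnIn openGraph openCluster openGraph_adj)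
open scoped BigOperators

noncomputable section
open Classical

variable {n : ℕ}

/-- **The good-quadruple functional is affine in the weight of a pair at the observer.**  With
`LHS_w = μ_w(o ↔ A, o ↮ b) + Σ_{W ∋ o, W ∩ A = ∅} μ_w(C(o) = W) · μ_w((sel W ↔ b in Wᶜ)ᶜ)` and
`e = s(o, y)`, `o ≠ y`: `LHS_w = (1 − w e) · LHS_{w[e↦0]} + (w e) · LHS_{w[e↦1]}` — each
`μ_w(C(o) = W)` and the live failure are affine (`goodStep_real_decomp`), and the factors
`μ((sel W ↔ b in Wᶜ)ᶜ)` do not see the pair `e` at `o ∈ W` (`goodStep_openConnIn_toggle`). [folklore] -/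
theorem goodStep_lhs_affine (w : Sym2 (Fin n) → unitInterval) (A : Finset (Fin n)) {o y : Fin n}
    (b : Fin n) (hoy : o ≠ y) (sel : Finset (Fin n) → Fin n) :
    (prodBernoulli w).real ((⋃ a ∈ A, openConn o a) ∩ (openConn o b)ᶜ)
        + ∑ W ∈ (Finset.univ : Finset (Finset (Fin n))).filter (fun W => o ∈ W ∧ Disjoint W A),
            (prodBernoulli w).real {ω : BondConfig (Fin n) | openCluster ω o = (W : Set (Fin n))}
              * (prodBernoulli w).real (openConnIn ((W : Set (Fin n))ᶜ) (sel W) b)ᶜ =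
      (1 - (w s(o, y) : ℝ)) *
        ((prodBernoulli (Function.update w s(o, y) 0)).real ((⋃ a ∈ A, openConn o a) ∩ (openConn o b)ᶜ)
          + ∑ W ∈ (Finset.univ : Finset (Finset (Fin n))).filter (fun W => o ∈ W ∧ Disjoint W A),
            (prodBernoulli (Function.update w s(o, y) 0)).real
                {ω : BondConfig (Fin n) | openCluster ω o = (W : Set (Fin n))}
              * (prodBernoulli (Function.update w s(o, y) 0)).real
                  (openConnIn ((W : Set (Fin n))ᶜ) (sel W) b)ᶜ) +
      (w s(o, y) : ℝ) *
        ((prodBernoulli (Function.update w s(o, y) 1)).real ((⋃ a ∈ A, openConn o a) ∩ (openConn o b)ᶜ)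
          + ∑ W ∈ (Finset.univ : Finset (Finset (Fin n))).filter (fun W => o ∈ W ∧ Disjoint W A),
            (prodBernoulli (Function.update w s(o, y) 1)).real
                {ω : BondConfig (Fin n) | openCluster ω o = (W : Set (Fin n))}
              * (prodBernoulli (Function.update w s(o, y) 1)).real
                  (openConnIn ((W : Set (Fin n))ᶜ) (sel W) b)ᶜ) := by
  have key : ∀ W ∈ (Finset.univ : Finset (Finset (Fin n))).filter (fun W => o ∈ W ∧ Disjoint W A),
      (prodBernoulli w).real {ω : BondConfig (Fin n) | openCluster ω o = (W : Set (Fin n))}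
          * (prodBernoulli w).real (openConnIn ((W : Set (Fin n))ᶜ) (sel W) b)ᶜ =
        (1 - (w s(o, y) : ℝ)) *
          ((prodBernoulli (Function.update w s(o, y) 0)).real
              {ω : BondConfig (Fin n) | openCluster ω o = (W : Set (Fin n))}
            * (prodBernoulli (Function.update w s(o, y) 0)).real
                (openConnIn ((W : Set (Fin n))ᶜ) (sel W) b)ᶜ) +
        (w s(o, y) : ℝ) *
          ((prodBernoulli (Function.update w s(o, y) 1)).real
              {ω : BondConfig (Fin n) | openCluster ω o = (W : Set (Fin n))}
            * (prodBernoulli (Function.update w s(o, y) 1)).real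
                (openConnIn ((W : Set (Fin n))ᶜ) (sel W) b)ᶜ) := by
    intro W hW
    have hoW : o ∈ (W : Set (Fin n)) := by
      rw [Finset.mem_filter] at hW
      exact Finset.mem_coe.2 hW.2.1
    have hinv := goodStep_real_update_eq_of_invariant w hoy (openConnIn ((W : Set (Fin n))ᶜ) (sel W) b)ᶜ
      (fun ω => by rw [Set.mem_compl_iff, Set.mem_compl_iff, (goodStep_openConnIn_toggle hoW y (sel W) b ω).1])
      (fun ω => by rw [Set.mem_compl_iff, Set.mem_compl_iff, (goodStep_openConnIn_toggle hoW y (sel W) b ω).2])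
    rw [hinv.1, hinv.2, goodStep_real_decomp w hoy {ω : BondConfig (Fin n) | openCluster ω o = (W : Set (Fin n))}]
    ring
  rw [Finset.sum_congr rfl key, Finset.sum_add_distrib, ← Finset.mul_sum, ← Finset.mul_sum,
    goodStep_real_decomp w hoy ((⋃ a ∈ A, openConn o a) ∩ (openConn o b)ᶜ)]
  ring

/-- Closing a pair does not increase the number of positive-degree vertices. [folklore] -/
theorem goodStep_posdeg_update_zero_le (w : Sym2 (Fin n) → unitInterval) (e : Sym2 (Fin n)) :
    (Finset.univ.filter (fun v : Fin n => ∃ u : Fin n, 0 < ((Function.update w e 0) s(u, v) : ℝ))).card ≤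
      (Finset.univ.filter (fun v : Fin n => ∃ u : Fin n, 0 < (w s(u, v) : ℝ))).card := by
  refine Finset.card_le_card fun v hv => ?_
  rw [Finset.mem_filter] at hv ⊢
  obtain ⟨u, hu⟩ := hv.2
  refine ⟨hv.1, u, ?_⟩
  by_cases h : s(u, v) = e
  · rw [h, Function.update_self] at hu
    simp at hu
  · rwa [Function.update_of_ne h] at hu

/-- Closing the pair `s(o, y₀)` removes exactly `y₀` from the set of low neighbours of `o`. [folklore] -/
theorem goodStep_lowset_update (w : Sym2 (Fin n) → unitInterval) (A : Finset (Fin n)) (o y₀ : Fin n) :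
    Finset.univ.filter (fun y : Fin n => y ∉ A ∧ y ≠ o ∧ (Function.update w s(o, y₀) 0) s(o, y) ≠ 0) =
      (Finset.univ.filter (fun y : Fin n => y ∉ A ∧ y ≠ o ∧ w s(o, y) ≠ 0)).erase y₀ := by
  ext y
  simp only [Finset.mem_filter, Finset.mem_univ, true_and, Finset.mem_erase, ne_eq]
  by_cases hy : y = y₀
  · subst hy
    simp
  · have hne : s(o, y) ≠ s(o, y₀) := fun h => hy (Sym2.congr_right.1 h)
    rw [Function.update_of_ne hne]
    tauto

/-- **`stub_goodStep` from the one-pair gluing step.**  Hypothesis `hglue` (the GLUING STEP, "DG1"):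
for weights `w` with the pair `s(o, x)` CLOSED (`x ∉ A`, `x ≠ o`), a relay `a₀ ∈ A` minimising
`μ_w(· ↔ b)` over `A`, goodness of `(w, A, o, b)` and goodness of every quadruple on fewer
positive-degree vertices, the quadruple obtained by OPENING `s(o, x)` (weight `1`, i.e. gluing the
low vertex `x` onto the observer) is good AGAINST THE OLD MINIMISER `a₀`:
`LHS_{w[ox↦1]}(sel) ≤ 1 − μ_{w[ox↦1]}(a₀ ↔ b)` for every selection.  Conclusion: exactly the
registered signature of `stub_goodStep` (skeleton `Cruxes/AdditiveGluing/Lines/subuniform-dead-pocket-maximum.lean`).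
Proof: induction on the number `k` of low neighbours `y ∉ A` of `o` with `w s(o,y) ≠ 0`.  `k = 0` is
the landed base `stub_goodBase` + `stub_lemma5AnyRelay` (KN Thm 4).  For `k + 1`, close one low pair
`e = s(o, y₀)`: `w⁰ = w[e ↦ 0]` is good by induction (its positive-degree count did not grow, so the
outer hypothesis transfers); with `a₀` the `μ_{w⁰}`-minimiser, goodness of `w⁰` at level
`1 − μ_{w⁰}(a₀ ↔ b)` gives `LHS_{w⁰} ≤ 1 − μ_{w⁰}(a₀ ↔ b)`, `hglue` gives
`LHS_{w[e↦1]} ≤ 1 − μ_{w[e↦1]}(a₀ ↔ b)`, and both `LHS` and `μ(a₀ ↔ b)` are affine in `w e`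
(`goodStep_lhs_affine`, `goodStep_real_decomp`), so `LHS_w ≤ 1 − μ_w(a₀ ↔ b) ≤ t`. -/
theorem goodStep_of_glueStep
    (hglue : ∀ (n : ℕ) (w : Sym2 (Fin n) → unitInterval) (A : Finset (Fin n)) (o x b a₀ : Fin n),
      b ∈ A → o ∉ A → x ∉ A → x ≠ o → w s(o, x) = 0 → a₀ ∈ A →
      (∀ a ∈ A, (prodBernoulli w).real (openConn a₀ b) ≤ (prodBernoulli w).real (openConn a b)) →
      (∀ (t : ℝ) (sel : Finset (Fin n) → Fin n), (∀ W, sel W ∈ A) →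
        (∀ a ∈ A, 1 - t ≤ (prodBernoulli w).real (openConn a b)) →
        ((prodBernoulli w).real ((⋃ a ∈ A, openConn o a) ∩ (openConn o b)ᶜ)
            + ∑ W ∈ (Finset.univ : Finset (Finset (Fin n))).filter (fun W => o ∈ W ∧ Disjoint W A),
                (prodBernoulli w).real {ω : BondConfig (Fin n) | openCluster ω o = (W : Set (Fin n))}
                  * (prodBernoulli w).real (openConnIn ((W : Set (Fin n))ᶜ) (sel W) b)ᶜ) ≤ t) →
      (∀ w' : Sym2 (Fin n) → unitInterval,
        (Finset.univ.filter (fun v : Fin n => ∃ u : Fin n, 0 < (w' s(u, v) : ℝ))).card < (Finset.univ.filter (fun v : Fin n => ∃ u : Fin n, 0 < (w s(u, v) : ℝ))).card →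
        ∀ (A' : Finset (Fin n)) (o' b' : Fin n), b' ∈ A' → o' ∉ A' →
        ∀ (t : ℝ) (sel : Finset (Fin n) → Fin n), (∀ W, sel W ∈ A') →
          (∀ a ∈ A', 1 - t ≤ (prodBernoulli w').real (openConn a b')) →
          ((prodBernoulli w').real ((⋃ a ∈ A', openConn o' a) ∩ (openConn o' b')ᶜ)
            + ∑ W ∈ (Finset.univ : Finset (Finset (Fin n))).filter (fun W => o' ∈ W ∧ Disjoint W A'),
                (prodBernoulli w').real {ω : BondConfig (Fin n) | openCluster ω o' = (W : Set (Fin n))}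
                  * (prodBernoulli w').real (openConnIn ((W : Set (Fin n))ᶜ) (sel W) b')ᶜ) ≤ t) →
      ∀ (sel : Finset (Fin n) → Fin n), (∀ W, sel W ∈ A) →
        ((prodBernoulli (Function.update w s(o, x) 1)).real ((⋃ a ∈ A, openConn o a) ∩ (openConn o b)ᶜ)
            + ∑ W ∈ (Finset.univ : Finset (Finset (Fin n))).filter (fun W => o ∈ W ∧ Disjoint W A),
                (prodBernoulli (Function.update w s(o, x) 1)).real {ω : BondConfig (Fin n) | openCluster ω o = (W : Set (Fin n))}
                  * (prodBernoulli (Function.update w s(o, x) 1)).real (openConnIn ((W : Set (Fin n))ᶜ) (sel W) b)ᶜ) ≤ 1 - (prodBernoulli (Function.update w s(o, x) 1)).real (openConn a₀ b)) :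
    ∀ (n : ℕ) (w : Sym2 (Fin n) → unitInterval) (A : Finset (Fin n)) (o b : Fin n),
      b ∈ A → o ∉ A →
      (∃ y : Fin n, y ∉ A ∧ y ≠ o ∧ (w s(o, y) : ℝ) ≠ 0) →
      (∀ w' : Sym2 (Fin n) → unitInterval,
        (Finset.univ.filter (fun v : Fin n => ∃ u : Fin n, 0 < (w' s(u, v) : ℝ))).card
          < (Finset.univ.filter (fun v : Fin n => ∃ u : Fin n, 0 < (w s(u, v) : ℝ))).card →
        ∀ (A' : Finset (Fin n)) (o' b' : Fin n), b' ∈ A' → o' ∉ A' →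
        ∀ (t : ℝ) (sel : Finset (Fin n) → Fin n), (∀ W, sel W ∈ A') →
          (∀ a ∈ A', 1 - t ≤ (prodBernoulli w').real (openConn a b')) →
          (prodBernoulli w').real ((⋃ a ∈ A', openConn o' a) ∩ (openConn o' b')ᶜ)
            + ∑ W ∈ (Finset.univ : Finset (Finset (Fin n))).filter (fun W => o' ∈ W ∧ Disjoint W A'),
                (prodBernoulli w').real {ω : BondConfig (Fin n) | openCluster ω o' = (W : Set (Fin n))}
                  * (prodBernoulli w').real (openConnIn ((W : Set (Fin n))ᶜ) (sel W) b')ᶜ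
            ≤ t) →
      ∀ (t : ℝ) (sel : Finset (Fin n) → Fin n), (∀ W, sel W ∈ A) →
        (∀ a ∈ A, 1 - t ≤ (prodBernoulli w).real (openConn a b)) →
        (prodBernoulli w).real ((⋃ a ∈ A, openConn o a) ∩ (openConn o b)ᶜ)
          + ∑ W ∈ (Finset.univ : Finset (Finset (Fin n))).filter (fun W => o ∈ W ∧ Disjoint W A),
              (prodBernoulli w).real {ω : BondConfig (Fin n) | openCluster ω o = (W : Set (Fin n))}
                * (prodBernoulli w).real (openConnIn ((W : Set (Fin n))ᶜ) (sel W) b)ᶜ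
          ≤ t := by
  intro n w A o b hb ho _hlow hIH
  -- inner induction on the number of low neighbours `y ∉ A`, `y ≠ o`, `w s(o,y) ≠ 0`
  suffices h : ∀ (k : ℕ) (w : Sym2 (Fin n) → unitInterval),
      (Finset.univ.filter (fun y : Fin n => y ∉ A ∧ y ≠ o ∧ w s(o, y) ≠ 0)).card = k →
      (∀ w' : Sym2 (Fin n) → unitInterval,
        (Finset.univ.filter (fun v : Fin n => ∃ u : Fin n, 0 < (w' s(u, v) : ℝ))).card
          < (Finset.univ.filter (fun v : Fin n => ∃ u : Fin n, 0 < (w s(u, v) : ℝ))).card →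
        ∀ (A' : Finset (Fin n)) (o' b' : Fin n), b' ∈ A' → o' ∉ A' →
        ∀ (t : ℝ) (sel : Finset (Fin n) → Fin n), (∀ W, sel W ∈ A') →
          (∀ a ∈ A', 1 - t ≤ (prodBernoulli w').real (openConn a b')) →
          (prodBernoulli w').real ((⋃ a ∈ A', openConn o' a) ∩ (openConn o' b')ᶜ)
            + ∑ W ∈ (Finset.univ : Finset (Finset (Fin n))).filter (fun W => o' ∈ W ∧ Disjoint W A'),
                (prodBernoulli w').real {ω : BondConfig (Fin n) | openCluster ω o' = (W : Set (Fin n))}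
                  * (prodBernoulli w').real (openConnIn ((W : Set (Fin n))ᶜ) (sel W) b')ᶜ
            ≤ t) →
      ∀ (t : ℝ) (sel : Finset (Fin n) → Fin n), (∀ W, sel W ∈ A) →
        (∀ a ∈ A, 1 - t ≤ (prodBernoulli w).real (openConn a b)) →
        (prodBernoulli w).real ((⋃ a ∈ A, openConn o a) ∩ (openConn o b)ᶜ)
          + ∑ W ∈ (Finset.univ : Finset (Finset (Fin n))).filter (fun W => o ∈ W ∧ Disjoint W A),
              (prodBernoulli w).real {ω : BondConfig (Fin n) | openCluster ω o = (W : Set (Fin n))}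
                * (prodBernoulli w).real (openConnIn ((W : Set (Fin n))ᶜ) (sel W) b)ᶜ
          ≤ t from h _ w rfl hIH
  intro k
  induction k with
  | zero =>
    intro w hk _hIHw t sel hsel ht
    -- no low neighbour: the landed base (KN Thm 4 class)
    have hiso : ∀ y : Fin n, y ∉ A → y ≠ o → (w s(o, y) : ℝ) = 0 := by
      intro y hyA hyo
      by_contra hne
      have hmem : y ∈ Finset.univ.filter (fun y : Fin n => y ∉ A ∧ y ≠ o ∧ w s(o, y) ≠ 0) :=
        Finset.mem_filter.2 ⟨Finset.mem_univ _, hyA, hyo, fun h => hne (by rw [h]; rfl)⟩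
      rw [Finset.card_eq_zero.1 hk] at hmem
      exact Finset.notMem_empty _ hmem
    exact stub_goodBase stub_lemma5AnyRelay n w A o b hb ho hiso t sel hsel ht
  | succ k ihk =>
    intro w hk hIHw t sel hsel ht
    -- pick a low neighbour `y₀` and close the pair `e = s(o, y₀)`
    obtain ⟨y₀, hy₀⟩ : (Finset.univ.filter (fun y : Fin n => y ∉ A ∧ y ≠ o ∧ w s(o, y) ≠ 0)).Nonempty := by
      rw [← Finset.card_pos, hk]; exact Nat.succ_pos k
    have hy₀' := (Finset.mem_filter.1 hy₀).2
    have hoy : o ≠ y₀ := fun h => hy₀'.2.1 h.symm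
    set w₀ : Sym2 (Fin n) → unitInterval := Function.update w s(o, y₀) 0 with hw₀
    have hcard : (Finset.univ.filter (fun y : Fin n => y ∉ A ∧ y ≠ o ∧ w₀ s(o, y) ≠ 0)).card = k := by
      rw [hw₀, goodStep_lowset_update, Finset.card_erase_of_mem hy₀, hk]
      rfl
    have hIH₀ : ∀ w' : Sym2 (Fin n) → unitInterval,
        (Finset.univ.filter (fun v : Fin n => ∃ u : Fin n, 0 < (w' s(u, v) : ℝ))).card
          < (Finset.univ.filter (fun v : Fin n => ∃ u : Fin n, 0 < (w₀ s(u, v) : ℝ))).card →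
        ∀ (A' : Finset (Fin n)) (o' b' : Fin n), b' ∈ A' → o' ∉ A' →
        ∀ (t : ℝ) (sel : Finset (Fin n) → Fin n), (∀ W, sel W ∈ A') →
          (∀ a ∈ A', 1 - t ≤ (prodBernoulli w').real (openConn a b')) →
          (prodBernoulli w').real ((⋃ a ∈ A', openConn o' a) ∩ (openConn o' b')ᶜ)
            + ∑ W ∈ (Finset.univ : Finset (Finset (Fin n))).filter (fun W => o' ∈ W ∧ Disjoint W A'),
                (prodBernoulli w').real {ω : BondConfig (Fin n) | openCluster ω o' = (W : Set (Fin n))}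
                  * (prodBernoulli w').real (openConnIn ((W : Set (Fin n))ᶜ) (sel W) b')ᶜ
            ≤ t :=
      fun w' hw' => hIHw w' (lt_of_lt_of_le hw' (goodStep_posdeg_update_zero_le w s(o, y₀)))
    have hgood₀ := ihk w₀ hcard hIH₀
    -- the minimiser `a₀` of `μ_{w₀}(· ↔ b)` over `A`
    obtain ⟨a₀, ha₀A, hmin⟩ := Finset.exists_min_image A
      (fun a => (prodBernoulli w₀).real (openConn a b)) ⟨b, hb⟩
    -- the gluing step at `w₀` (pair `s(o, y₀)` closed) against `a₀`
    have he₀ : w₀ s(o, y₀) = 0 := by rw [hw₀, Function.update_self]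
    have h1 := hglue n w₀ A o y₀ b a₀ hb ho hy₀'.1 hy₀'.2.1 he₀ ha₀A hmin hgood₀ hIH₀ sel hsel
    have hupd : Function.update w₀ s(o, y₀) 1 = Function.update w s(o, y₀) 1 := by
      rw [hw₀, Function.update_idem]
    rw [hupd] at h1
    -- goodness of `w₀` at level `1 − μ_{w₀}(a₀ ↔ b)`
    have h0 := hgood₀ (1 - (prodBernoulli w₀).real (openConn a₀ b)) sel hsel
      (fun a ha => by linarith [hmin a ha])
    -- both sides are affine in `w s(o, y₀)`
    have haff := goodStep_lhs_affine w A b hoy sel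
    have hτ := goodStep_real_decomp w hoy (openConn a₀ b)
    have hta := ht a₀ ha₀A
    have hp0 : 0 ≤ (w s(o, y₀) : ℝ) := unitInterval.nonneg _
    have hp1 : (w s(o, y₀) : ℝ) ≤ 1 := unitInterval.le_one _
    rw [haff]
    rw [← hw₀] at hτ ⊢
    nlinarith [mul_le_mul_of_nonneg_left h0 (sub_nonneg.2 hp1), mul_le_mul_of_nonneg_left h1 hp0, hτ, hta]

/-- **Registered sub-goal `stub_goodStepOfGlueStep_k8`** (siege k8): the gluing step `GlueStep`
implies the registered signature of `stub_goodStep` (= `goodStep_of_glueStep`, one line). -/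
theorem stub_goodStepOfGlueStep_k8 : (∀ (n : ℕ) (w : Sym2 (Fin n) → unitInterval) (A : Finset (Fin n)) (o x b a₀ : Fin n), b ∈ A → o ∉ A → x ∉ A → x ≠ o → w s(o, x) = 0 → a₀ ∈ A → (∀ a ∈ A, (prodBernoulli w).real (openConn a₀ b) ≤ (prodBernoulli w).real (openConn a b)) → (∀ (t : ℝ) (sel : Finset (Fin n) → Fin n), (∀ W, sel W ∈ A) → (∀ a ∈ A, 1 - t ≤ (prodBernoulli w).real (openConn a b)) → ((prodBernoulli w).real ((⋃ a ∈ A, openConn o a) ∩ (openConn o b)ᶜ) + ∑ W ∈ (Finset.univ : Finset (Finset (Fin n))).filter (fun W => o ∈ W ∧ Disjoint W A), (prodBernoulli w).real {ω : BondConfig (Fin n) | openCluster ω o = (W : Set (Fin n))} * (prodBernoulli w).real (openConnIn ((W : Set (Fin n))ᶜ) (sel W) b)ᶜ) ≤ t) → (∀ w' : Sym2 (Fin n) → unitInterval, (Finset.univ.filter (fun v : Fin n => ∃ u : Fin n, 0 < (w' s(u, v) : ℝ))).card < (Finset.univ.filter (fun v : Fin n => ∃ u : Fin n, 0 < (w s(u,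 v) : ℝ))).card → ∀ (A' : Finset (Fin n)) (o' b' : Fin n), b' ∈ A' → o' ∉ A' → ∀ (t : ℝ) (sel : Finset (Fin n) → Fin n), (∀ W, sel W ∈ A') → (∀ a ∈ A', 1 - t ≤ (prodBernoulli w').real (openConn a b')) → ((prodBernoulli w').real ((⋃ a ∈ A', openConn o' a) ∩ (openConn o' b')ᶜ) + ∑ W ∈ (Finset.univ : Finset (Finset (Fin n))).filter (fun W => o' ∈ W ∧ Disjoint W A'), (prodBernoulli w').real {ω : BondConfig (Fin n) | openCluster ω o' = (W : Set (Fin n))} * (prodBernoulli w').real (openConnIn ((W : Set (Fin n))ᶜ) (sel W) b')ᶜ) ≤ t) → ∀ (sel : Finset (Fin n) → Fin n), (∀ W, sel W ∈ A) → ((prodBernoulli (Function.update w s(o, x) 1)).real ((⋃ a ∈ A, openConn o a) ∩ (openConn o b)ᶜ) + ∑ W ∈ (Finset.univ : Finset (Finset (Fin n))).filter (fun W => o ∈ W ∧ Disjoint W A), (prodBernoulli (Function.update w s(o, x) 1)).real {ω : BondConfig (Fin n) | openCluster ω o = (W : Set (Fin n))} * (prodBernoulli (Function.update w s(o, x) 1)).real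 (openConnIn ((W : Set (Fin n))ᶜ) (sel W) b)ᶜ) ≤ 1 - (prodBernoulli (Function.update w s(o, x) 1)).real (openConn a₀ b)) → ∀ (n : ℕ) (w : Sym2 (Fin n) → unitInterval) (A : Finset (Fin n)) (o b : Fin n), b ∈ A → o ∉ A → (∃ y : Fin n, y ∉ A ∧ y ≠ o ∧ (w s(o, y) : ℝ) ≠ 0) → (∀ w' : Sym2 (Fin n) → unitInterval, (Finset.univ.filter (fun v : Fin n => ∃ u : Fin n, 0 < (w' s(u, v) : ℝ))).card < (Finset.univ.filter (fun v : Fin n => ∃ u : Fin n, 0 < (w s(u, v) : ℝ))).card → ∀ (A' : Finset (Fin n)) (o' b' : Fin n), b' ∈ A' → o' ∉ A' → ∀ (t : ℝ) (sel : Finset (Fin n) → Fin n), (∀ W, sel W ∈ A') → (∀ a ∈ A', 1 - t ≤ (prodBernoulli w').real (openConn a b')) → ((prodBernoulli w').real ((⋃ a ∈ A', openConn o' a) ∩ (openConn o' b')ᶜ) + ∑ W ∈ (Finset.univ : Finset (Finset (Fin n))).filter (fun W => o' ∈ W ∧ Disjoint W A'), (prodBernoulli w').real {ω : BondConfig (Fin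 n) | openCluster ω o' = (W : Set (Fin n))} * (prodBernoulli w').real (openConnIn ((W : Set (Fin n))ᶜ) (sel W) b')ᶜ) ≤ t) → ∀ (t : ℝ) (sel : Finset (Fin n) → Fin n), (∀ W, sel W ∈ A) → (∀ a ∈ A, 1 - t ≤ (prodBernoulli w).real (openConn a b)) → ((prodBernoulli w).real ((⋃ a ∈ A, openConn o a) ∩ (openConn o b)ᶜ) + ∑ W ∈ (Finset.univ : Finset (Finset (Fin n))).filter (fun W => o ∈ W ∧ Disjoint W A), (prodBernoulli w).real {ω : BondConfig (Fin n) | openCluster ω o = (W : Set (Fin n))} * (prodBernoulli w).real (openConnIn ((W : Set (Fin n))ᶜ) (sel W) b)ᶜ) ≤ t :=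
  goodStep_of_glueStep

end

end Summit.CriticalPhenomena.PercolationContinuityZ3.Theorems
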